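import Mathlib.Geometry.Manifold.Diffeomorph
import Mathlib.Geometry.Manifold.ContMDiff.Atlas
import Mathlib.Geometry.Manifold.ContMDiff.NormedSpace
import Mathlib.Geometry.Manifold.SmoothEmbedding
import Mathlib.Analysis.Calculus.FDeriv.Comp
import Mathlib.Analysis.Calculus.FDeriv.Equiv
import Literature.Topology.FourManifolds.GluckTwistProofs
import Literature.Topology.FourManifolds.SmoothEmbeddingCriteria
import HarnessLib

/-!
# Transport of compactly supported diffeomorphisms along charts; equidimensional embeddings

Topic `Literature/Topology/FourManifolds`. Manifold-side toolkit for the flow-free proof of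
**Palais' disc theorem** in ball-complement form (`PalaisBallComplement.lean`, discharging
`Literature.Topology.FourManifolds.Knot.palais_ballComplement_sphere_four` of `HomotopyBallSliceProofs.lean`).

## Informal content

1. **Transport along a chart** (`chartTransport`, `exists_diffeomorph_chartTransport`): let
   `φ : M ⊇ U → E` be a smooth chart of `M` onto the *whole* model vector space `E` (smooth with
   smooth inverse) and `s` a diffeomorphism of `E` equal to the identity outside a ball
   `B̄(0, R)`. Then `φ⁻¹ ∘ s ∘ φ` on `U`, extended by the identity, is a diffeomorphism `H` of `M`
   with `H ∘ φ⁻¹ = φ⁻¹ ∘ s` and `H = id` off `φ⁻¹(B̄(0, R))`. This is the (static form of the)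
   extension by the identity of a compactly supported diffeotopy of an open subset, Hirsch,
   *Differential Topology* (1976), Ch. 8, §1 (Thms. 1.3–1.4) and proof of Thm. 3.2 ("such a
   diffeotopy extends to all of `M` …"). `exists_chart_symm_eq_comp` reparametrises such a
   chart by a diffeomorphism of `E`.
2. **Derivatives of partial diffeomorphisms** (`OpenPartialHomeomorph.exists_hasFDerivAt_equiv`,
   an `Literature`-namespaced lemma): a partial homeomorphism `T` of `E`, differentiable at `x ∈ T.source`
   with inverse differentiable at `T x`, has an invertible derivative at `x` (chain rule).
3. **Equidimensional smooth embeddings** (`exists_chart_of_isSmoothEmbedding`): a smooth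
   embedding `e : E → M` of the finite-dimensional model space `E` into a manifold modelled on
   `E` (Mathlib `Manifold.IsSmoothEmbedding 𝓘(ℝ, E) 𝓘(ℝ, E) ∞ e`) is a diffeomorphism onto an
   open subset, packaged as a chart `Φ` of `M` with `Φ.symm = e`, `Φ.target = E`,
   `Φ.source = range e` and `Φ` smooth on its source. This merely packages two results of the
   tree: `e` is open (`Manifold.IsSmoothEmbedding.isOpenMap_of_finrank_eq`,
   `GluckTwistProofs.lean`) and the inverse of an open smooth embedding is smooth on the range
   (`contMDiffOn_symm_of_isSmoothEmbedding`, `SmoothEmbeddingCriteria.lean`).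

## Design

Charts are Mathlib `OpenPartialHomeomorph M E` with `target = univ`; the model is
`𝓘(ℝ, E)` (so `𝓡 n` for `E = EuclideanSpace ℝ (Fin n)`). Support control is phrased as
`∀ y, R ≤ ‖y‖ → s y = y`, matching `CompactlySupportedDiffeo.lean`.

## References

* M. W. Hirsch, *Differential Topology*, GTM 33, Springer (1976), Ch. 8, §1 (Thms. 1.3, 1.4),
  §3 (proof of Thm. 3.2); Ch. 1, §3 (embeddings and immersions) [Hirsch1976].
* J. M. Lee, *Introduction to Smooth Manifolds*, 2nd ed., GTM 218 (2013), Ch. 4–5.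
-/

open scoped Manifold ContDiff Topology
open Function Set

noncomputable section

namespace Literature.Topology.FourManifolds

/-! ## Transport of compactly supported diffeomorphisms of the model along a chart -/

section Transport

variable {E : Type*} [NormedAddCommGroup E] {M : Type*} [TopologicalSpace M]

open Classical in
/-- The transport of a self-map `s` of the model `E` along a partial homeomorphism
`φ : M → E` with `φ.target = E`: `φ⁻¹ ∘ s ∘ φ` on `φ.source`, the identity elsewhere.
[folklore] -/
def chartTransport (φ : OpenPartialHomeomorph M E) (s : E → E) (x : M) : M :=
  if x ∈ φ.source then φ.symm (s (φ x)) else x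

variable {φ : OpenPartialHomeomorph M E}

/-- On the chart domain the transport is `φ⁻¹ ∘ s ∘ φ`. [folklore] -/
theorem chartTransport_of_mem (s : E → E) {x : M} (hx : x ∈ φ.source) :
    chartTransport φ s x = φ.symm (s (φ x)) := by
  simp [chartTransport, hx]

/-- Off the chart domain the transport is the identity. [folklore] -/
theorem chartTransport_of_not_mem (s : E → E) {x : M} (hx : x ∉ φ.source) :
    chartTransport φ s x = x := by
  simp [chartTransport, hx]

/-- The defining relation `H ∘ φ⁻¹ = φ⁻¹ ∘ s` of the transport `H`. [folklore] -/
theorem chartTransport_symm_apply (htarget : φ.target = univ) (s : E → E) (y : E) :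
    chartTransport φ s (φ.symm y) = φ.symm (s y) := by
  have hy : y ∈ φ.target := by simp [htarget]
  rw [chartTransport_of_mem s (φ.map_target hy), φ.right_inv hy]

/-- Outside `φ⁻¹(B̄(0, R))` the transport of a map supported in `B̄(0, R)` is the identity.
[folklore] -/
theorem chartTransport_eq_self {s : E → E} {R : ℝ} (hs : ∀ y, R ≤ ‖y‖ → s y = y) {x : M}
    (hx : x ∉ φ.symm '' Metric.closedBall (0 : E) R) : chartTransport φ s x = x := by
  by_cases hxs : x ∈ φ.source
  · rw [chartTransport_of_mem s hxs]
    have hR : R ≤ ‖φ x‖ := by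
      by_contra hlt
      exact hx ⟨φ x, by simpa using (not_le.mp hlt).le, φ.left_inv hxs⟩
    rw [hs _ hR, φ.left_inv hxs]
  · exact chartTransport_of_not_mem s hxs

/-- Transports of mutually inverse maps are mutually inverse. [folklore] -/
theorem chartTransport_chartTransport (htarget : φ.target = univ) {s t : E → E}
    (hst : ∀ y, t (s y) = y) (x : M) :
    chartTransport φ t (chartTransport φ s x) = x := by
  by_cases hxs : x ∈ φ.source
  · rw [chartTransport_of_mem s hxs, chartTransport_symm_apply htarget, hst, φ.left_inv hxs]
  · rw [chartTransport_of_not_mem s hxs, chartTransport_of_not_mem t hxs]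

variable [NormedSpace ℝ E] [ChartedSpace E M] [T2Space M] [ProperSpace E]

/-- The transport of a smooth map supported in a ball, along a smooth chart with smooth inverse and
full target, is smooth (it is `φ⁻¹ ∘ s ∘ φ` near the chart domain and the identity near the closed
set `M ∖ φ⁻¹(B̄(0, R))`, whose union is `M`). [folklore] -/
theorem contMDiff_chartTransport (hφ : ContMDiffOn 𝓘(ℝ, E) 𝓘(ℝ, E) ∞ φ φ.source)
    (hφ' : ContMDiff 𝓘(ℝ, E) 𝓘(ℝ, E) ∞ φ.symm) (htarget : φ.target = univ)
    {s : E → E} (hsm : ContMDiff 𝓘(ℝ, E) 𝓘(ℝ, E) ∞ s) {R : ℝ} (hs : ∀ y, R ≤ ‖y‖ → s y = y) :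
    ContMDiff 𝓘(ℝ, E) 𝓘(ℝ, E) ∞ (chartTransport φ s) := by
  intro x
  by_cases hxs : x ∈ φ.source
  · have hev : chartTransport φ s =ᶠ[𝓝 x] fun z ↦ φ.symm (s (φ z)) :=
      Filter.eventuallyEq_of_mem (φ.open_source.mem_nhds hxs)
        fun z hz ↦ chartTransport_of_mem s hz
    refine ContMDiffAt.congr_of_eventuallyEq ?_ hev
    exact hφ'.contMDiffAt.comp x (hsm.contMDiffAt.comp x (hφ.contMDiffAt
      (φ.open_source.mem_nhds hxs)))
  · have hK : IsClosed (φ.symm '' Metric.closedBall (0 : E) R) :=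
      ((isCompact_closedBall (0 : E) R).image_of_continuousOn
        (hφ'.continuous.continuousOn)).isClosed
    have hxK : x ∉ φ.symm '' Metric.closedBall (0 : E) R := by
      rintro ⟨y, -, rfl⟩
      exact hxs (φ.map_target (by simp [htarget]))
    have hev : chartTransport φ s =ᶠ[𝓝 x] id :=
      Filter.eventuallyEq_of_mem (hK.isOpen_compl.mem_nhds hxK)
        fun z hz ↦ chartTransport_eq_self hs hz
    exact contMDiffAt_id.congr_of_eventuallyEq hev

/-- **Transport of a compactly supported diffeomorphism along a chart with full target.**
Let `φ : M ⊇ U → E` be a smooth chart of `M` onto the whole model space `E` (smooth with smooth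
inverse) and `s` a diffeomorphism of `E` equal to the identity outside a ball. Then
`φ⁻¹ ∘ s ∘ φ`, extended by the identity, is a diffeomorphism `H` of `M` with
`H ∘ φ⁻¹ = φ⁻¹ ∘ s` and `H = id` off `φ⁻¹(B̄(0, R))`. Static form of the extension by the identity of a
compactly supported diffeotopy, Hirsch (1976), Ch. 8, §1 (Thms. 1.3–1.4) and proof of Thm. 3.2.
[folklore] -/
theorem exists_diffeomorph_chartTransport (hφ : ContMDiffOn 𝓘(ℝ, E) 𝓘(ℝ, E) ∞ φ φ.source)
    (hφ' : ContMDiff 𝓘(ℝ, E) 𝓘(ℝ, E) ∞ φ.symm) (htarget : φ.target = univ)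
    (s : E ≃ₘ⟮𝓘(ℝ, E), 𝓘(ℝ, E)⟯ E) {R : ℝ} (hs : ∀ y, R ≤ ‖y‖ → s y = y) :
    ∃ H : M ≃ₘ⟮𝓘(ℝ, E), 𝓘(ℝ, E)⟯ M, (∀ y, H (φ.symm y) = φ.symm (s y)) ∧
      ∀ x, x ∉ φ.symm '' Metric.closedBall (0 : E) R → H x = x := by
  have hs' : ∀ y, R ≤ ‖y‖ → s.symm y = y := fun y hy ↦ by
    conv_lhs => rw [← hs y hy]
    exact s.symm_apply_apply y
  let H : M ≃ₘ⟮𝓘(ℝ, E), 𝓘(ℝ, E)⟯ M :=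
    { toFun := chartTransport φ s
      invFun := chartTransport φ s.symm
      left_inv := chartTransport_chartTransport htarget s.symm_apply_apply
      right_inv := chartTransport_chartTransport htarget s.apply_symm_apply
      contMDiff_toFun := contMDiff_chartTransport hφ hφ' htarget s.contMDiff hs
      contMDiff_invFun := contMDiff_chartTransport hφ hφ' htarget s.symm.contMDiff hs' }
  exact ⟨H, fun y ↦ chartTransport_symm_apply htarget s y, fun x hx ↦ chartTransport_eq_self hs hx⟩

omit [T2Space M] [ProperSpace E] in
/-- **Reparametrising a full-target chart by a diffeomorphism of the model.** If `φ : M ⊇ U → E`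
is a smooth chart onto `E`, then so is `D⁻¹ ∘ φ` for every diffeomorphism `D` of `E`, with
inverse `φ⁻¹ ∘ D` and the same source. [folklore] -/
theorem exists_chart_symm_eq_comp (hφ : ContMDiffOn 𝓘(ℝ, E) 𝓘(ℝ, E) ∞ φ φ.source)
    (htarget : φ.target = univ) (D : E ≃ₘ⟮𝓘(ℝ, E), 𝓘(ℝ, E)⟯ E) :
    ∃ φ' : OpenPartialHomeomorph M E, φ'.target = univ ∧ ⇑φ'.symm = φ.symm ∘ D ∧
      φ'.source = φ.source ∧ ContMDiffOn 𝓘(ℝ, E) 𝓘(ℝ, E) ∞ φ' φ'.source := by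
  refine ⟨φ.trans D.symm.toHomeomorph.toOpenPartialHomeomorph, ?_, ?_, ?_, ?_⟩
  · rw [OpenPartialHomeomorph.trans_target, htarget]
    simp
  · rw [OpenPartialHomeomorph.coe_trans_symm]
    rfl
  · rw [OpenPartialHomeomorph.trans_source]
    simp
  · have h1 : ContMDiffOn 𝓘(ℝ, E) 𝓘(ℝ, E) ∞ (D.symm ∘ φ) φ.source :=
      D.symm.contMDiff.comp_contMDiffOn hφ
    refine h1.congr_mono (fun y _ ↦ ?_) ?_
    · simp
    · rw [OpenPartialHomeomorph.trans_source]
      exact inter_subset_left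

end Transport

/-! ## Local diffeomorphisms of the model have invertible derivative -/

section Deriv

variable {E : Type*} [NormedAddCommGroup E] [NormedSpace ℝ E]

/-- A partial homeomorphism of `E` differentiable at `x` with inverse differentiable at the
image point has an invertible derivative at `x` (chain rule). [folklore] -/
theorem OpenPartialHomeomorph.exists_hasFDerivAt_equiv (T : OpenPartialHomeomorph E E) {x : E}
    (hx : x ∈ T.source) (hT : DifferentiableAt ℝ T x) (hT' : DifferentiableAt ℝ T.symm (T x)) :
    ∃ L : E ≃L[ℝ] E, HasFDerivAt T (L : E →L[ℝ] E) x := by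
  set L₁ := fderiv ℝ T x
  set L₂ := fderiv ℝ T.symm (T x)
  have h1 : L₂.comp L₁ = ContinuousLinearMap.id ℝ E := by
    have hc : HasFDerivAt (T.symm ∘ T) (L₂.comp L₁) x := hT'.hasFDerivAt.comp x hT.hasFDerivAt
    have hid : HasFDerivAt (T.symm ∘ T) (ContinuousLinearMap.id ℝ E) x :=
      (hasFDerivAt_id x).congr_of_eventuallyEq
        ((T.eventually_left_inverse hx).mono fun y hy ↦ by simpa using hy)
    exact hc.unique hid
  have h2 : L₁.comp L₂ = ContinuousLinearMap.id ℝ E := by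
    have hTd : HasFDerivAt T L₁ (T.symm (T x)) := by
      rw [T.left_inv hx]; exact hT.hasFDerivAt
    have hc : HasFDerivAt (T ∘ T.symm) (L₁.comp L₂) (T x) := hTd.comp (T x) hT'.hasFDerivAt
    have hid : HasFDerivAt (T ∘ T.symm) (ContinuousLinearMap.id ℝ E) (T x) :=
      (hasFDerivAt_id (T x)).congr_of_eventuallyEq
        ((T.eventually_right_inverse' hx).mono fun y hy ↦ by simpa using hy)
    exact hc.unique hid
  refine ⟨ContinuousLinearEquiv.equivOfInverse L₁ L₂ (fun y ↦ ?_) (fun y ↦ ?_), hT.hasFDerivAt⟩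
  · simpa using congrArg (fun A : E →L[ℝ] E ↦ A y) h1
  · simpa using congrArg (fun A : E →L[ℝ] E ↦ A y) h2

end Deriv

/-! ## Equidimensional smooth embeddings of the model space are diffeomorphisms onto open sets -/

section Equidim

variable {E : Type*} [NormedAddCommGroup E] [NormedSpace ℝ E] [FiniteDimensional ℝ E]
  {M : Type*} [TopologicalSpace M] [ChartedSpace E M]

/-- **An equidimensional smooth embedding of the model space is a diffeomorphism onto an open
subset**, packaged as a smooth chart `Φ : M ⊇ e(E) → E` of `M` with `Φ.symm = e` and full
target. `e` is open by invariance of domain for equidimensional smooth embeddings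
(`Manifold.IsSmoothEmbedding.isOpenMap_of_finrank_eq`, `GluckTwistProofs.lean`), and the inverse
of an open smooth embedding is smooth on its range (`contMDiffOn_symm_of_isSmoothEmbedding`,
`SmoothEmbeddingCriteria.lean`); Lee, *Introduction to Smooth Manifolds* (2013), Prop. 5.2 /
Thm. 4.14 as cited there. [folklore] -/
theorem exists_chart_of_isSmoothEmbedding {e : E → M}
    (h : Manifold.IsSmoothEmbedding 𝓘(ℝ, E) 𝓘(ℝ, E) ∞ e) :
    ∃ Φ : OpenPartialHomeomorph M E, Φ.target = univ ∧ ⇑Φ.symm = e ∧ Φ.source = range e ∧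
      ContMDiffOn 𝓘(ℝ, E) 𝓘(ℝ, E) ∞ Φ Φ.source := by
  haveI : Nonempty M := ⟨e 0⟩
  have hopen : IsOpenMap e := Manifold.IsSmoothEmbedding.isOpenMap_of_finrank_eq h rfl
  have hemb : Topology.IsOpenEmbedding e :=
    .of_continuous_injective_isOpenMap h.contMDiff.continuous h.isEmbedding.injective hopen
  refine ⟨(hemb.toOpenPartialHomeomorph e).symm, by simp, by simp, by simp, ?_⟩
  simpa using contMDiffOn_symm_of_isSmoothEmbedding h hemb

end Equidim

end Literature.Topology.FourManifolds

end
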